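import Summits.CriticalPhenomena.PercolationContinuityZ3.Theorems.PercNearOneGluingNoHeavyLowerTailIncStarBridgeEvents
import Summits.CriticalPhenomena.PercolationContinuityZ3.Theorems.PercNearOneGluingAdditiveGluingTieLiftOne
import Literature.Probability.Percolation.ShorteningInfluenceBound
import HarnessLib

/-!
# The BRANCH LEMMA (Br) of the apex-forest calculus, I: the bridge step

Support file for the Sahi programme (`--supports stmt-CriticalPhenomena-4575`, prover prim-sahi-p2 gen 19).  No definitions, no named
facts, no sorries; standard axioms.  Memo `run/shared/lean/prim/prim-sahi/FROM-prim-nh-lead-4575-g120-STAR-HALF.md` §5(iv) (lead g120) and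
`prim-sahi-p2/PROOF-E3.md` (29d′)/(29f).

The branch lemma is the one forest-specific inequality behind both the R-side lemma of THEOREM C½ (STAR½ on apex-forests) and THEOREM
(I2′)-tree (hence FC): for a port-tree with port `w₀`, target `t` and root coins, `D + 2H ≥ A(π + G)`.  In root-connection language (this
file's formulation, equivalent to the lead's by `F ∖ W = {t ~ w₀ off-root} ∖ W` and `F ∪ T = Z`): with `P = prodBernoulli w`, root `s`,
  `(Br)(w; w₀, t):  P(w₀↛s)·P(t↔w₀ ∨ s↔t) ≤ P(t↔w₀ ∧ w₀↛s) + 2·P(w₀↛s ∧ t↮w₀ ∧ s↔t)`.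
It is FALSE on general graphs (`K₄ − e`, lit g57 §64) and holds on apex-forests by the lead's port-tree recursion.  In the fixed-vertex formalism
the recursion is a BRIDGE STEP exactly like Theorem B's (`…IncStarBridgeEvents/…Chord`): if `t` lies in the near side `L` of an environment
bridge `e₁ = s(x₁, w₀)` (`x₁ ∈ L`, `w₀ ∉ L`), then conditioning on `e₁` (`prodBernoulli_real_oneBond`, `tieLiftOne_real_one_eq`), the cut-vertex
dictionary under `w[e₁↦0]` and the independence of the two blocks give
  `P(t↔w₀ ∧ w₀↛s) = p·A′D₁`, `P(w₀↛s ∧ t↮w₀ ∧ s↔t) = (1−p)A′m₁ + pA′H₁`, `P(w₀↛s) = (1−p)A′ + pA′A₁`, `P(t↔w₀ ∨ s↔t) = (1−p)m₁ + pZ₁`,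
with `p = w e₁`, `A′ = P₀(w₀↛s)` and the quantities `A₁, D₁, H₁, m₁, Z₁ = m₁ + D₁` of the instance `(w[e₁↦0]; x₁, t)`; and then
`(Br)(w[e₁↦0]; x₁, t) ⟹ (Br)(w; w₀, t)` by the real-arithmetic identity
`RHS − LHS = A′·[(1−p)(2pH₁ + m₁(1 − pA₁)) + p²(D₁ + 2H₁ − A₁Z₁)]` (`branchLemma_real`; PROOF-E3 (29d′)).

* `indep_blocks` — events determined inside `insert s L` and inside `Lᶜ` are independent (any weight);
* `branchLemma_real` — the arithmetic step;
* **`branchLemma_bridge_step`** — `(Br)` at `(w[e₁↦0]; x₁, t)` implies `(Br)` at `(w; w₀, t)` across an environment bridge `s(x₁, w₀)`.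
Part II (`…IncStarBranchLemma`) runs the induction over the forest.
-/

noncomputable section

namespace Summit.CriticalPhenomena.PercolationContinuityZ3.Theorems

namespace IncStar

open MeasureTheory Set Literature.Probability.Percolation Literature.Probability.LatticeModels EdgeInduction
open scoped Classical

variable {n : ℕ}

/-- **Independence of the two blocks at the root.**  An event determined by the off-diagonal pairs inside `insert s L` and an event
determined by the off-diagonal pairs inside `Lᶜ` are independent under every `prodBernoulli w` (the two coordinate sets are disjoint:
a pair inside both would be the loop at `s`). [folklore] -/
theorem indep_blocks (w : Sym2 (Fin n) → unitInterval) (L : Set (Fin n)) (s : Fin n) {A B : Set (BondConfig (Fin n))}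
    (hA : DeterminedBy A {z : Sym2 (Fin n) | ¬ z.IsDiag ∧ ∀ x ∈ z, x ∈ insert s L})
    (hB : DeterminedBy B {z : Sym2 (Fin n) | ¬ z.IsDiag ∧ ∀ x ∈ z, x ∈ Lᶜ}) :
    (prodBernoulli w).real (A ∩ B) = (prodBernoulli w).real A * (prodBernoulli w).real B := by
  set K : Finset (Sym2 (Fin n)) := Finset.univ.filter fun z : Sym2 (Fin n) => ¬ z.IsDiag ∧ ∀ x ∈ z, x ∈ insert s L with hK
  have hKcoe : (↑K : Set (Sym2 (Fin n))) = {z : Sym2 (Fin n) | ¬ z.IsDiag ∧ ∀ x ∈ z, x ∈ insert s L} := by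
    ext z; simp [hK]
  have hA' : DeterminedBy A (↑K : Set (Sym2 (Fin n))) := by rw [hKcoe]; exact hA
  have hB' : DeterminedBy B (↑K : Set (Sym2 (Fin n)))ᶜ := by
    refine hB.mono fun z hz hzK => ?_
    rw [hKcoe] at hzK
    obtain ⟨hnd, hz₂⟩ := hz
    obtain ⟨-, hz₁⟩ := hzK
    revert hnd hz₁ hz₂
    refine Sym2.inductionOn z fun p q => ?_
    intro hnd hz₂ hz₁
    have hp : p = s := bridge_cv_hV L s p (hz₁ p (Sym2.mem_mk_left p q)) (hz₂ p (Sym2.mem_mk_left p q))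
    have hq : q = s := bridge_cv_hV L s q (hz₁ q (Sym2.mem_mk_right p q)) (hz₂ q (Sym2.mem_mk_right p q))
    exact hnd (by rw [Sym2.mk_isDiag_iff, hp, hq])
  exact prodBernoulli_real_inter_of_determinedBy w K hA' hB' MeasurableSet.of_discrete MeasurableSet.of_discrete

/-- **The arithmetic of the bridge step of (Br).** [this work] -/
theorem branchLemma_real (p A' A₁ m₁ D₁ H₁ : ℝ) (hp0 : 0 ≤ p) (hp1 : p ≤ 1) (hA' : 0 ≤ A') (hA₁ : A₁ ≤ 1)
    (hm : 0 ≤ m₁) (hH : 0 ≤ H₁) (IH : A₁ * (m₁ + D₁) ≤ D₁ + 2 * H₁) :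
    ((1 - p) * A' + p * (A' * A₁)) * ((1 - p) * m₁ + p * (m₁ + D₁))
      ≤ p * (A' * D₁) + 2 * ((1 - p) * (A' * m₁) + p * (A' * H₁)) := by
  rw [← sub_nonneg]
  have key : p * (A' * D₁) + 2 * ((1 - p) * (A' * m₁) + p * (A' * H₁))
      - ((1 - p) * A' + p * (A' * A₁)) * ((1 - p) * m₁ + p * (m₁ + D₁))
      = A' * ((1 - p) * (2 * p * H₁ + m₁ * (1 - p * A₁)) + p ^ 2 * (D₁ + 2 * H₁ - A₁ * (m₁ + D₁))) := by ring
  rw [key]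
  have h1 : 0 ≤ 1 - p * A₁ := by nlinarith
  have h2 : 0 ≤ (1 - p) * (2 * p * H₁ + m₁ * (1 - p * A₁)) :=
    mul_nonneg (by linarith) (add_nonneg (by positivity) (mul_nonneg hm h1))
  have h3 : 0 ≤ p ^ 2 * (D₁ + 2 * H₁ - A₁ * (m₁ + D₁)) := mul_nonneg (by positivity) (by linarith)
  exact mul_nonneg hA' (add_nonneg h2 h3)

/-- **(Br), the bridge step.**  Near side `L ∌ s` with `x₁, t ∈ L`, `w₀ ∉ L`, and no positive pair from `L` to `(L ∪ {s})ᶜ` other than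
`e₁ = s(x₁, w₀)`.  If `(Br)` holds for the pinned weight `w[e₁↦0]` at port `x₁` and target `t`, then `(Br)` holds for `w` at port `w₀` and
target `t`. [this work] -/
theorem branchLemma_bridge_step (w : Sym2 (Fin n) → unitInterval) (L : Set (Fin n)) {s x₁ w₀ t : Fin n}
    (hsL : s ∉ L) (hxL : x₁ ∈ L) (hwL : w₀ ∉ L) (htL : t ∈ L)
    (hcross : ∀ x y : Fin n, x ∈ L → y ∉ L → y ≠ s → s(x, y) ≠ s(x₁, w₀) → w s(x, y) = 0)
    (IH : (prodBernoulli (Function.update w s(x₁, w₀) 0)).real (openConn s x₁)ᶜ *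
        (prodBernoulli (Function.update w s(x₁, w₀) 0)).real (openConn t x₁ ∪ openConn s t)
      ≤ (prodBernoulli (Function.update w s(x₁, w₀) 0)).real (openConn t x₁ \ openConn s x₁)
        + 2 * (prodBernoulli (Function.update w s(x₁, w₀) 0)).real ((openConn s x₁)ᶜ ∩ (openConn t x₁)ᶜ ∩ openConn s t)) :
    (prodBernoulli w).real (openConn s w₀)ᶜ * (prodBernoulli w).real (openConn t w₀ ∪ openConn s t)
      ≤ (prodBernoulli w).real (openConn t w₀ \ openConn s w₀)
        + 2 * (prodBernoulli w).real ((openConn s w₀)ᶜ ∩ (openConn t w₀)ᶜ ∩ openConn s t) := by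
  -- names
  set e : Sym2 (Fin n) := s(x₁, w₀)
  set w0 := Function.update w e 0 with hw0
  set w1 := Function.update w e 1
  have hs1 : s ∈ insert s L := Set.mem_insert s L
  have hx1 : x₁ ∈ insert s L := Set.mem_insert_of_mem s hxL
  have ht1 : t ∈ insert s L := Set.mem_insert_of_mem s htL
  -- near events `T1, S, F` and the far event `W'`
  set T1 : Set (BondConfig (Fin n)) := openConnIn (insert s L) s t
  set S : Set (BondConfig (Fin n)) := openConnIn (insert s L) s x₁
  set F : Set (BondConfig (Fin n)) := openConnIn (insert s L) t x₁
  set W' : Set (BondConfig (Fin n)) := openConnIn Lᶜ s w₀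
  -- (0) the bridge hypothesis under `w0`, the almost-sure set, independence
  have hw0cross : ∀ x y : Fin n, x ∈ L → y ∉ L → y ≠ s → w0 s(x, y) = 0 := by
    intro x y hx hy hys
    by_cases hxy : s(x, y) = e
    · rw [hxy, hw0, Function.update_self]
    · rw [hw0, Function.update_of_ne hxy]; exact hcross x y hx hy hys hxy
  set G : Set (BondConfig (Fin n)) := {ω | ∀ e', w0 e' = 0 → e' ∉ ω}
  have hG1 : (prodBernoulli w0).real G = 1 := real_sureClosed w0
  have hωG : ∀ ω ∈ G, ∀ x y : Fin n, x ∈ L → y ∉ L → y ≠ s → s(x, y) ∉ ω :=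
    fun ω hω x y hx hy hys => hω _ (hw0cross x y hx hy hys)
  have hm : ∀ X : Set (BondConfig (Fin n)), MeasurableSet X := fun _ => MeasurableSet.of_discrete
  have hdiff : ∀ {A B : Set (BondConfig (Fin n))} {K' : Set (Sym2 (Fin n))},
      DeterminedBy A K' → DeterminedBy B K' → DeterminedBy (A \ B) K' := by
    intro A B K' hA hB
    rw [determinedBy_iff] at hA hB ⊢
    intro ω ω' h
    rw [Set.mem_sdiff, Set.mem_sdiff, hA ω ω' h, hB ω ω' h]
  have hdn : ∀ x y : Fin n, DeterminedBy (openConnIn (insert s L) x y : Set (BondConfig (Fin n)))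
      {z : Sym2 (Fin n) | ¬ z.IsDiag ∧ ∀ x ∈ z, x ∈ insert s L} := fun x y => IncStarCutVertex.determinedBy_openConnIn_offDiag _ x y
  have hdW' : DeterminedBy W' {z : Sym2 (Fin n) | ¬ z.IsDiag ∧ ∀ x ∈ z, x ∈ Lᶜ} :=
    IncStarCutVertex.determinedBy_openConnIn_offDiag _ s w₀
  have hdW'c : DeterminedBy (Set.univ \ W') {z : Sym2 (Fin n) | ¬ z.IsDiag ∧ ∀ x ∈ z, x ∈ Lᶜ} := hdiff (determinedBy_univ _) hdW'
  have indep : ∀ {A B : Set (BondConfig (Fin n))}, DeterminedBy A {z : Sym2 (Fin n) | ¬ z.IsDiag ∧ ∀ x ∈ z, x ∈ insert s L} →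
      DeterminedBy B {z : Sym2 (Fin n) | ¬ z.IsDiag ∧ ∀ x ∈ z, x ∈ Lᶜ} →
      (prodBernoulli w0).real (A ∩ B) = (prodBernoulli w0).real A * (prodBernoulli w0).real B :=
    fun hA hB => indep_blocks w0 L s hA hB
  -- (1) dictionary on the sure set
  have c_sw : ∀ ω ∈ G, (ω ∈ openConn s w₀ ↔ ω ∈ W') := fun ω hω => by
    rw [bridge_conn_lr L hsL (hωG ω hω) hs1 hwL]
    exact ⟨fun h => h.2, fun h => ⟨⟨hs1, hs1, SimpleGraph.Reachable.refl _⟩, h⟩⟩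
  have c_st : ∀ ω ∈ G, (ω ∈ openConn s t ↔ ω ∈ T1) := fun ω hω => bridge_conn_ll L hsL (hωG ω hω) hs1 ht1
  have c_tw : ∀ ω ∈ G, (ω ∈ openConn t w₀ ↔ ω ∈ T1 ∧ ω ∈ W') := fun ω hω => by
    rw [bridge_conn_lr L hsL (hωG ω hω) ht1 hwL]
    exact ⟨fun h => ⟨openConnIn_symm' h.1, h.2⟩, fun h => ⟨openConnIn_symm' h.1, h.2⟩⟩
  have c_sx : ∀ ω ∈ G, (ω ∈ openConn s x₁ ↔ ω ∈ S) := fun ω hω => bridge_conn_ll L hsL (hωG ω hω) hs1 hx1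
  have c_tx : ∀ ω ∈ G, (ω ∈ openConn t x₁ ↔ ω ∈ F) := fun ω hω => bridge_conn_ll L hsL (hωG ω hω) ht1 hx1
  -- (2) lifted events after inserting `e`
  have l_sw : ∀ ω ∈ G, (insert e ω ∈ openConn s w₀ ↔ ω ∈ W' ∨ ω ∈ S) := fun ω hω => by
    rw [bridge_lift_far L hsL hxL hwL hwL (hωG ω hω)]
    have hww : ω ∈ openConnIn Lᶜ w₀ w₀ := ⟨hwL, hwL, SimpleGraph.Reachable.refl _⟩
    exact ⟨fun h => h.imp id fun h' => h'.1, fun h => h.imp id fun h' => ⟨h', hww⟩⟩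
  have l_st : ∀ ω ∈ G, (insert e ω ∈ openConn s t ↔ ω ∈ T1 ∨ (ω ∈ W' ∧ ω ∈ F)) := fun ω hω => by
    rw [bridge_lift_near L hsL hxL hwL htL (hωG ω hω)]
    exact ⟨fun h => h.imp id fun h' => ⟨h'.1, openConnIn_symm' h'.2⟩, fun h => h.imp id fun h' => ⟨h'.1, openConnIn_symm' h'.2⟩⟩
  have l_tw : ∀ ω ∈ G, (insert e ω ∈ openConn t w₀ ↔ (ω ∈ T1 ∧ ω ∈ W') ∨ ω ∈ F) := fun ω hω => by
    rw [insert_pair_mem_openConn_iff, c_tw ω hω, c_tx ω hω]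
    have hww : ω ∈ openConn w₀ w₀ := SimpleGraph.Reachable.refl _
    constructor
    · rintro (h | ⟨h1, -⟩)
      · exact Or.inl h
      · exact h1.symm
    · rintro (h | h)
      · exact Or.inl h
      · exact Or.inr ⟨Or.inl h, Or.inr hww⟩
  -- (3) one-bond decomposition and the lift
  have ob : ∀ A : Set (BondConfig (Fin n)),
      (prodBernoulli w).real A = (1 - (w e : ℝ)) * (prodBernoulli w0).real A + (w e : ℝ) * (prodBernoulli w1).real A := by
    intro A
    have hA : DeterminedBy A (↑(Finset.univ : Finset (Sym2 (Fin n))) : Set (Sym2 (Fin n))) := by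
      rw [determinedBy_iff]
      intro ω ω' h
      rw [Finset.coe_univ, Set.inter_univ, Set.inter_univ] at h
      rw [h]
    exact prodBernoulli_real_oneBond hA w (Finset.mem_univ e)
  have lift : ∀ A : Set (BondConfig (Fin n)),
      (prodBernoulli w1).real A = (prodBernoulli w0).real ((fun ω : BondConfig (Fin n) => insert e ω) ⁻¹' A) :=
    fun A => tieLiftOne_real_one_eq w e A
  -- (4) the four moments under `w0`
  have a0 : (prodBernoulli w0).real (openConn s w₀)ᶜ = (prodBernoulli w0).real (Set.univ \ W') :=
    real_congr_of_sure hG1 fun ω hω => by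
      rw [Set.mem_compl_iff, c_sw ω hω, Set.mem_sdiff]; exact ⟨fun h => ⟨Set.mem_univ _, h⟩, fun h => h.2⟩
  have d0 : (prodBernoulli w0).real (openConn t w₀ \ openConn s w₀) = 0 := by
    have h : (prodBernoulli w0).real (openConn t w₀ \ openConn s w₀) = (prodBernoulli w0).real (∅ : Set (BondConfig (Fin n))) :=
      real_congr_of_sure hG1 fun ω hω => by
        rw [Set.mem_sdiff, c_tw ω hω, c_sw ω hω]
        exact ⟨fun h => (h.2 h.1.2).elim, fun h => (Set.notMem_empty _ h).elim⟩
    rw [h, measureReal_empty]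
  have h0 : (prodBernoulli w0).real ((openConn s w₀)ᶜ ∩ (openConn t w₀)ᶜ ∩ openConn s t)
      = (prodBernoulli w0).real T1 * (prodBernoulli w0).real (Set.univ \ W') := by
    rw [← indep (hdn s t) hdW'c]
    refine real_congr_of_sure hG1 fun ω hω => ?_
    simp only [Set.mem_inter_iff, Set.mem_compl_iff, Set.mem_sdiff, Set.mem_univ, true_and, c_sw ω hω, c_tw ω hω, c_st ω hω]
    tauto
  have z0 : (prodBernoulli w0).real (openConn t w₀ ∪ openConn s t) = (prodBernoulli w0).real T1 :=
    real_congr_of_sure hG1 fun ω hω => by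
      rw [Set.mem_union, c_tw ω hω, c_st ω hω]; exact ⟨fun h => h.elim (fun h' => h'.1) id, fun h => Or.inr h⟩
  -- (5) the four moments under `w1`
  have a1 : (prodBernoulli w1).real (openConn s w₀)ᶜ
      = (prodBernoulli w0).real (Set.univ \ S) * (prodBernoulli w0).real (Set.univ \ W') := by
    rw [lift, ← indep (hdiff (determinedBy_univ _) (hdn s x₁)) hdW'c]
    refine real_congr_of_sure hG1 fun ω hω => ?_
    simp only [Set.preimage_compl, Set.mem_compl_iff, Set.mem_preimage, l_sw ω hω, Set.mem_inter_iff, Set.mem_sdiff,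
      Set.mem_univ, true_and]
    tauto
  have d1 : (prodBernoulli w1).real (openConn t w₀ \ openConn s w₀)
      = (prodBernoulli w0).real (F \ S) * (prodBernoulli w0).real (Set.univ \ W') := by
    rw [lift, ← indep (hdiff (hdn t x₁) (hdn s x₁)) hdW'c]
    refine real_congr_of_sure hG1 fun ω hω => ?_
    simp only [Set.preimage_sdiff, Set.mem_sdiff, Set.mem_preimage, l_tw ω hω, l_sw ω hω, Set.mem_inter_iff, Set.mem_univ,
      true_and]
    tauto
  have h1 : (prodBernoulli w1).real ((openConn s w₀)ᶜ ∩ (openConn t w₀)ᶜ ∩ openConn s t)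
      = (prodBernoulli w0).real ((T1 \ S) \ F) * (prodBernoulli w0).real (Set.univ \ W') := by
    rw [lift, ← indep (hdiff (hdiff (hdn s t) (hdn s x₁)) (hdn t x₁)) hdW'c]
    refine real_congr_of_sure hG1 fun ω hω => ?_
    simp only [Set.preimage_inter, Set.preimage_compl, Set.mem_inter_iff, Set.mem_compl_iff, Set.mem_preimage,
      l_sw ω hω, l_tw ω hω, l_st ω hω, Set.mem_sdiff, Set.mem_univ, true_and]
    tauto
  have z1 : (prodBernoulli w1).real (openConn t w₀ ∪ openConn s t) = (prodBernoulli w0).real (F ∪ T1) := by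
    rw [lift]
    refine real_congr_of_sure hG1 fun ω hω => ?_
    simp only [Set.preimage_union, Set.mem_union, Set.mem_preimage, l_tw ω hω, l_st ω hω]
    tauto
  -- (6) the sub-instance quantities in block form
  have eA₁ : (prodBernoulli w0).real (openConn s x₁)ᶜ = (prodBernoulli w0).real (Set.univ \ S) :=
    real_congr_of_sure hG1 fun ω hω => by
      rw [Set.mem_compl_iff, c_sx ω hω, Set.mem_sdiff]; exact ⟨fun h => ⟨Set.mem_univ _, h⟩, fun h => h.2⟩
  have eD₁ : (prodBernoulli w0).real (openConn t x₁ \ openConn s x₁) = (prodBernoulli w0).real (F \ S) :=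
    real_congr_of_sure hG1 fun ω hω => by rw [Set.mem_sdiff, Set.mem_sdiff, c_tx ω hω, c_sx ω hω]
  have eH₁ : (prodBernoulli w0).real ((openConn s x₁)ᶜ ∩ (openConn t x₁)ᶜ ∩ openConn s t)
      = (prodBernoulli w0).real ((T1 \ S) \ F) :=
    real_congr_of_sure hG1 fun ω hω => by
      simp only [Set.mem_inter_iff, Set.mem_compl_iff, c_sx ω hω, c_tx ω hω, c_st ω hω, Set.mem_sdiff]; tauto
  have eZ₁ : (prodBernoulli w0).real (openConn t x₁ ∪ openConn s t) = (prodBernoulli w0).real (F ∪ T1) :=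
    real_congr_of_sure hG1 fun ω hω => by rw [Set.mem_union, Set.mem_union, c_tx ω hω, c_st ω hω]
  have em₁ : (prodBernoulli w0).real (openConn s t) = (prodBernoulli w0).real T1 := real_congr_of_sure hG1 c_st
  -- `Z₁ = m₁ + D₁`: `F ∪ T1 = T1 ⊔ (F ∖ S)` (on `F`, `t` is hit iff `x₁` is)
  have eZsplit : (prodBernoulli w0).real (F ∪ T1) = (prodBernoulli w0).real T1 + (prodBernoulli w0).real (F \ S) := by
    rw [← measureReal_union ?_ (hm _)]
    · congr 1
      ext ω
      simp only [Set.mem_union, Set.mem_sdiff]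
      constructor
      · rintro (hF | hT)
        · by_cases hT : ω ∈ T1
          · exact Or.inl hT
          · exact Or.inr ⟨hF, fun hS => hT (PlanarDuality.openConnIn_trans hS (openConnIn_symm' hF))⟩
        · exact Or.inl hT
      · rintro (hT | ⟨hF, -⟩)
        · exact Or.inr hT
        · exact Or.inl hF
    · exact Set.disjoint_left.2 fun ω hT hFS => hFS.2 (PlanarDuality.openConnIn_trans hT hFS.1)
  -- sign facts
  have hp0 : (0 : ℝ) ≤ w e := (w e).2.1
  have hp1 : (w e : ℝ) ≤ 1 := (w e).2.2
  have hA₁ : (prodBernoulli w0).real (Set.univ \ S) ≤ 1 := measureReal_le_one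
  -- (7) assemble
  have IH' : (prodBernoulli w0).real (Set.univ \ S) * ((prodBernoulli w0).real T1 + (prodBernoulli w0).real (F \ S))
      ≤ (prodBernoulli w0).real (F \ S) + 2 * (prodBernoulli w0).real ((T1 \ S) \ F) := by
    have h := IH
    rw [eA₁, eZ₁, eZsplit, eD₁, eH₁] at h
    exact h
  rw [ob (openConn s w₀)ᶜ, ob (openConn t w₀ ∪ openConn s t), ob (openConn t w₀ \ openConn s w₀),
    ob ((openConn s w₀)ᶜ ∩ (openConn t w₀)ᶜ ∩ openConn s t), a0, a1, z0, z1, eZsplit, d0, d1, h0, h1]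
  have key := branchLemma_real (w e) ((prodBernoulli w0).real (Set.univ \ W')) ((prodBernoulli w0).real (Set.univ \ S))
    ((prodBernoulli w0).real T1) ((prodBernoulli w0).real (F \ S)) ((prodBernoulli w0).real ((T1 \ S) \ F))
    hp0 hp1 measureReal_nonneg hA₁ measureReal_nonneg measureReal_nonneg IH'
  nlinarith [key]

end IncStar

end Summit.CriticalPhenomena.PercolationContinuityZ3.Theorems
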